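import Literature.NumberTheory.EllipticCurves.PointCountEulerCriterion
import HarnessLib
/-!
# BSD rank-≤1 residual cell, class X11b ∧ r = 1 ∧ p ≥ 5, SEMISTABLE in-window pairs: Frobenius
# point-count certificates `#Ẽ(𝔽_ℓ) = n` for the records of part 1 (kernel-decided data)

HONEST FRAMING (cell `b2b-bsdres-*`, verbatim): prove what is provable now; shrink each hard class
to its core with data; no claim beyond stated classes; COMBINATION classes deleted from PUBLISHED
theorems only, CONSTRUCTION-shaped remainder typed; this is not "finishing BSD". Class X11b stays
CONSTRUCTION-SHAPED; everything here is PER PAIR; no lane verdict is changed; no named fact.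

Unit `b2b-bsdres-x11c`, gen 9. Theorems only (no definition, no named fact, no `native_decide`), in the
exact shape of `Rank1ResidualX11RankOneFrobeniusCards{1,2}.lean` (the 85 non-semistable records) and
of the tree's `RationalIsogenyFrobeniusCertificates*.lean`: for each record of
`X11b/SemistableRecords1.lean` (Cremona label in the name, a-invariants literal) and ONE odd prime
`ℓ < 64` of good reduction (`ℓ ∤ Δ`, `ℓ ≠ p`; the smallest with `X² − a_ℓX + ℓ` root-free modulo the
record's `p`), the point count `#Ẽ(𝔽_ℓ) = n` of the reduction of the integer model, decided by the
kernel through `WeierstrassCurve.natCard_point_eq_one_add_card` and `card_sol_eq_sum_euler`. Consumer: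
`X11b/SemistableRecordsReduction.lean` (`a_ℓ = ℓ + 1 − n`, root-freeness decided there, `E[p]`
irreducible by Mazur 1978 Prop. 6.3 (1) via `IntModel.hasIrreducibleModPGaloisRep_of_intModel_of_noroot`).
Witnesses found by `code/b2b-bsdres-x11c/gen9/scan_sst58.py` (naive count); the kernel RE-VERIFIES
every count here.

References: B. Mazur, Invent. Math. 44 (1978) Prop. 6.3 (1) [Mazur1978]; K. Ireland, M. Rosen, GTM 84
(1990) §8.1 [IrelandRosen1990]; Cremona's tables [Cremona2006].
-/

namespace Summit.BirchSwinnertonDyer.Rank1Residual.X11b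

open Literature.NumberTheory.EllipticCurves

/-- `#Ẽ(𝔽_3) = 6` (`a_3 = -2`; `X² − a_3X + 3` root-free mod `p = 5`) for the semistable record `430d1`. [folklore] -/
theorem card_s430d1_3 :
    Nat.card (((⟨1, 0, 0, -1415, 20617⟩ : WeierstrassCurve ℤ).map (Int.castRingHom (ZMod 3))).toAffine.Point) = 6 := by
  rw [@WeierstrassCurve.natCard_point_eq_one_add_card (ZMod 3) (@ZMod.instField 3 ⟨by norm_num⟩) _ _ _
    (by decide +kernel), @card_sol_eq_sum_euler (ZMod 3) (@ZMod.instField 3 ⟨by norm_num⟩) _ _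
    (by rw [ZMod.ringChar_zmod_n]; decide), ZMod.card]
  decide +kernel

/-- `#Ẽ(𝔽_13) = 18` (`a_13 = -4`; `X² − a_13X + 13` root-free mod `p = 7`) for the semistable record `1155k1`. [folklore] -/
theorem card_s1155k1_13 :
    Nat.card (((⟨0, 1, 1, 545, 2734⟩ : WeierstrassCurve ℤ).map (Int.castRingHom (ZMod 13))).toAffine.Point) = 18 := by
  rw [@WeierstrassCurve.natCard_point_eq_one_add_card (ZMod 13) (@ZMod.instField 13 ⟨by norm_num⟩) _ _ _
    (by decide +kernel), @card_sol_eq_sum_euler (ZMod 13) (@ZMod.instField 13 ⟨by norm_num⟩) _ _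
    (by rw [ZMod.ringChar_zmod_n]; decide), ZMod.card]
  decide +kernel

/-- `#Ẽ(𝔽_7) = 8` (`a_7 = 0`; `X² − a_7X + 7` root-free mod `p = 5`) for the semistable record `1590i1`. [folklore] -/
theorem card_s1590i1_7 :
    Nat.card (((⟨1, 0, 1, -2803, -42802⟩ : WeierstrassCurve ℤ).map (Int.castRingHom (ZMod 7))).toAffine.Point) = 8 := by
  rw [@WeierstrassCurve.natCard_point_eq_one_add_card (ZMod 7) (@ZMod.instField 7 ⟨by norm_num⟩) _ _ _
    (by decide +kernel), @card_sol_eq_sum_euler (ZMod 7) (@ZMod.instField 7 ⟨by norm_num⟩) _ _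
    (by rw [ZMod.ringChar_zmod_n]; decide), ZMod.card]
  decide +kernel

/-- `#Ẽ(𝔽_3) = 7` (`a_3 = -3`; `X² − a_3X + 3` root-free mod `p = 5`) for the semistable record `2990g1`. [folklore] -/
theorem card_s2990g1_3 :
    Nat.card (((⟨1, -1, 1, -252, -321⟩ : WeierstrassCurve ℤ).map (Int.castRingHom (ZMod 3))).toAffine.Point) = 7 := by
  rw [@WeierstrassCurve.natCard_point_eq_one_add_card (ZMod 3) (@ZMod.instField 3 ⟨by norm_num⟩) _ _ _
    (by decide +kernel), @card_sol_eq_sum_euler (ZMod 3) (@ZMod.instField 3 ⟨by norm_num⟩) _ _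
    (by rw [ZMod.ringChar_zmod_n]; decide), ZMod.card]
  decide +kernel

/-- `#Ẽ(𝔽_13) = 17` (`a_13 = -3`; `X² − a_13X + 13` root-free mod `p = 5`) for the semistable record `3030u1`. [folklore] -/
theorem card_s3030u1_13 :
    Nat.card (((⟨1, 0, 0, -1110, 20772⟩ : WeierstrassCurve ℤ).map (Int.castRingHom (ZMod 13))).toAffine.Point) = 17 := by
  rw [@WeierstrassCurve.natCard_point_eq_one_add_card (ZMod 13) (@ZMod.instField 13 ⟨by norm_num⟩) _ _ _
    (by decide +kernel), @card_sol_eq_sum_euler (ZMod 13) (@ZMod.instField 13 ⟨by norm_num⟩) _ _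
    (by rw [ZMod.ringChar_zmod_n]; decide), ZMod.card]
  decide +kernel

/-- `#Ẽ(𝔽_13) = 14` (`a_13 = 0`; `X² − a_13X + 13` root-free mod `p = 5`) for the semistable record `3045j1`. [folklore] -/
theorem card_s3045j1_13 :
    Nat.card (((⟨1, 0, 0, -49315, 4204592⟩ : WeierstrassCurve ℤ).map (Int.castRingHom (ZMod 13))).toAffine.Point) = 14 := by
  rw [@WeierstrassCurve.natCard_point_eq_one_add_card (ZMod 13) (@ZMod.instField 13 ⟨by norm_num⟩) _ _ _
    (by decide +kernel), @card_sol_eq_sum_euler (ZMod 13) (@ZMod.instField 13 ⟨by norm_num⟩) _ _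
    (by rw [ZMod.ringChar_zmod_n]; decide), ZMod.card]
  decide +kernel

/-- `#Ẽ(𝔽_17) = 24` (`a_17 = -6`; `X² − a_17X + 17` root-free mod `p = 5`) for the semistable record `4830y1`. [folklore] -/
theorem card_s4830y1_17 :
    Nat.card (((⟨1, 1, 1, 288380, 108455045⟩ : WeierstrassCurve ℤ).map (Int.castRingHom (ZMod 17))).toAffine.Point) = 24 := by
  rw [@WeierstrassCurve.natCard_point_eq_one_add_card (ZMod 17) (@ZMod.instField 17 ⟨by norm_num⟩) _ _ _
    (by decide +kernel), @card_sol_eq_sum_euler (ZMod 17) (@ZMod.instField 17 ⟨by norm_num⟩) _ _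
    (by rw [ZMod.ringChar_zmod_n]; decide), ZMod.card]
  decide +kernel

/-- `#Ẽ(𝔽_7) = 13` (`a_7 = -5`; `X² − a_7X + 7` root-free mod `p = 5`) for the semistable record `6045f1`. [folklore] -/
theorem card_s6045f1_7 :
    Nat.card (((⟨0, 1, 1, -3621, -180439⟩ : WeierstrassCurve ℤ).map (Int.castRingHom (ZMod 7))).toAffine.Point) = 13 := by
  rw [@WeierstrassCurve.natCard_point_eq_one_add_card (ZMod 7) (@ZMod.instField 7 ⟨by norm_num⟩) _ _ _
    (by decide +kernel), @card_sol_eq_sum_euler (ZMod 7) (@ZMod.instField 7 ⟨by norm_num⟩) _ _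
    (by rw [ZMod.ringChar_zmod_n]; decide), ZMod.card]
  decide +kernel

/-- `#Ẽ(𝔽_3) = 4` (`a_3 = 0`; `X² − a_3X + 3` root-free mod `p = 5`) for the semistable record `6310e1`. [folklore] -/
theorem card_s6310e1_3 :
    Nat.card (((⟨1, -1, 1, -22, -379⟩ : WeierstrassCurve ℤ).map (Int.castRingHom (ZMod 3))).toAffine.Point) = 4 := by
  rw [@WeierstrassCurve.natCard_point_eq_one_add_card (ZMod 3) (@ZMod.instField 3 ⟨by norm_num⟩) _ _ _
    (by decide +kernel), @card_sol_eq_sum_euler (ZMod 3) (@ZMod.instField 3 ⟨by norm_num⟩) _ _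
    (by rw [ZMod.ringChar_zmod_n]; decide), ZMod.card]
  decide +kernel

/-- `#Ẽ(𝔽_11) = 13` (`a_11 = -1`; `X² − a_11X + 11` root-free mod `p = 7`) for the semistable record `6342m1`. [folklore] -/
theorem card_s6342m1_11 :
    Nat.card (((⟨1, 0, 0, -378, 2916⟩ : WeierstrassCurve ℤ).map (Int.castRingHom (ZMod 11))).toAffine.Point) = 13 := by
  rw [@WeierstrassCurve.natCard_point_eq_one_add_card (ZMod 11) (@ZMod.instField 11 ⟨by norm_num⟩) _ _ _
    (by decide +kernel), @card_sol_eq_sum_euler (ZMod 11) (@ZMod.instField 11 ⟨by norm_num⟩) _ _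
    (by rw [ZMod.ringChar_zmod_n]; decide), ZMod.card]
  decide +kernel

/-- `#Ẽ(𝔽_11) = 18` (`a_11 = -6`; `X² − a_11X + 11` root-free mod `p = 5`) for the semistable record `6510bb1`. [folklore] -/
theorem card_s6510bb1_11 :
    Nat.card (((⟨1, 0, 0, 50, -28⟩ : WeierstrassCurve ℤ).map (Int.castRingHom (ZMod 11))).toAffine.Point) = 18 := by
  rw [@WeierstrassCurve.natCard_point_eq_one_add_card (ZMod 11) (@ZMod.instField 11 ⟨by norm_num⟩) _ _ _
    (by decide +kernel), @card_sol_eq_sum_euler (ZMod 11) (@ZMod.instField 11 ⟨by norm_num⟩) _ _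
    (by rw [ZMod.ringChar_zmod_n]; decide), ZMod.card]
  decide +kernel

/-- `#Ẽ(𝔽_11) = 18` (`a_11 = -6`; `X² − a_11X + 11` root-free mod `p = 7`) for the semistable record `6510x1`. [folklore] -/
theorem card_s6510x1_11 :
    Nat.card (((⟨1, 0, 0, -8462601, 10074373785⟩ : WeierstrassCurve ℤ).map (Int.castRingHom (ZMod 11))).toAffine.Point) = 18 := by
  rw [@WeierstrassCurve.natCard_point_eq_one_add_card (ZMod 11) (@ZMod.instField 11 ⟨by norm_num⟩) _ _ _
    (by decide +kernel), @card_sol_eq_sum_euler (ZMod 11) (@ZMod.instField 11 ⟨by norm_num⟩) _ _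
    (by rw [ZMod.ringChar_zmod_n]; decide), ZMod.card]
  decide +kernel

/-- `#Ẽ(𝔽_31) = 23` (`a_31 = 9`; `X² − a_31X + 31` root-free mod `p = 5`) for the semistable record `6630h1`. [folklore] -/
theorem card_s6630h1_31 :
    Nat.card (((⟨1, 1, 0, 3823, -38259⟩ : WeierstrassCurve ℤ).map (Int.castRingHom (ZMod 31))).toAffine.Point) = 23 := by
  rw [@WeierstrassCurve.natCard_point_eq_one_add_card (ZMod 31) (@ZMod.instField 31 ⟨by norm_num⟩) _ _ _
    (by decide +kernel), @card_sol_eq_sum_euler (ZMod 31) (@ZMod.instField 31 ⟨by norm_num⟩) _ _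
    (by rw [ZMod.ringChar_zmod_n]; decide), ZMod.card]
  decide +kernel

/-- `#Ẽ(𝔽_11) = 8` (`a_11 = 4`; `X² − a_11X + 11` root-free mod `p = 5`) for the semistable record `6990n1`. [folklore] -/
theorem card_s6990n1_11 :
    Nat.card (((⟨1, 1, 1, 185, 797⟩ : WeierstrassCurve ℤ).map (Int.castRingHom (ZMod 11))).toAffine.Point) = 8 := by
  rw [@WeierstrassCurve.natCard_point_eq_one_add_card (ZMod 11) (@ZMod.instField 11 ⟨by norm_num⟩) _ _ _
    (by decide +kernel), @card_sol_eq_sum_euler (ZMod 11) (@ZMod.instField 11 ⟨by norm_num⟩) _ _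
    (by rw [ZMod.ringChar_zmod_n]; decide), ZMod.card]
  decide +kernel

/-- `#Ẽ(𝔽_7) = 8` (`a_7 = 0`; `X² − a_7X + 7` root-free mod `p = 5`) for the semistable record `6990o1`. [folklore] -/
theorem card_s6990o1_7 :
    Nat.card (((⟨1, 0, 0, -221, 4785⟩ : WeierstrassCurve ℤ).map (Int.castRingHom (ZMod 7))).toAffine.Point) = 8 := by
  rw [@WeierstrassCurve.natCard_point_eq_one_add_card (ZMod 7) (@ZMod.instField 7 ⟨by norm_num⟩) _ _ _
    (by decide +kernel), @card_sol_eq_sum_euler (ZMod 7) (@ZMod.instField 7 ⟨by norm_num⟩) _ _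
    (by rw [ZMod.ringChar_zmod_n]; decide), ZMod.card]
  decide +kernel

/-- `#Ẽ(𝔽_3) = 6` (`a_3 = -2`; `X² − a_3X + 3` root-free mod `p = 7`) for the semistable record `7259d1`. [folklore] -/
theorem card_s7259d1_3 :
    Nat.card (((⟨1, 0, 0, -260847, -50831834⟩ : WeierstrassCurve ℤ).map (Int.castRingHom (ZMod 3))).toAffine.Point) = 6 := by
  rw [@WeierstrassCurve.natCard_point_eq_one_add_card (ZMod 3) (@ZMod.instField 3 ⟨by norm_num⟩) _ _ _
    (by decide +kernel), @card_sol_eq_sum_euler (ZMod 3) (@ZMod.instField 3 ⟨by norm_num⟩) _ _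
    (by rw [ZMod.ringChar_zmod_n]; decide), ZMod.card]
  decide +kernel

/-- `#Ẽ(𝔽_7) = 7` (`a_7 = 1`; `X² − a_7X + 7` root-free mod `p = 5`) for the semistable record `7755i1`. [folklore] -/
theorem card_s7755i1_7 :
    Nat.card (((⟨1, 0, 0, -3830, -185223⟩ : WeierstrassCurve ℤ).map (Int.castRingHom (ZMod 7))).toAffine.Point) = 7 := by
  rw [@WeierstrassCurve.natCard_point_eq_one_add_card (ZMod 7) (@ZMod.instField 7 ⟨by norm_num⟩) _ _ _
    (by decide +kernel), @card_sol_eq_sum_euler (ZMod 7) (@ZMod.instField 7 ⟨by norm_num⟩) _ _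
    (by rw [ZMod.ringChar_zmod_n]; decide), ZMod.card]
  decide +kernel

/-- `#Ẽ(𝔽_13) = 14` (`a_13 = 0`; `X² − a_13X + 13` root-free mod `p = 5`) for the semistable record `7770bc1`. [folklore] -/
theorem card_s7770bc1_13 :
    Nat.card (((⟨1, 0, 0, -281490, 80204292⟩ : WeierstrassCurve ℤ).map (Int.castRingHom (ZMod 13))).toAffine.Point) = 14 := by
  rw [@WeierstrassCurve.natCard_point_eq_one_add_card (ZMod 13) (@ZMod.instField 13 ⟨by norm_num⟩) _ _ _
    (by decide +kernel), @card_sol_eq_sum_euler (ZMod 13) (@ZMod.instField 13 ⟨by norm_num⟩) _ _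
    (by rw [ZMod.ringChar_zmod_n]; decide), ZMod.card]
  decide +kernel

/-- `#Ẽ(𝔽_7) = 8` (`a_7 = 0`; `X² − a_7X + 7` root-free mod `p = 5`) for the semistable record `8430h1`. [folklore] -/
theorem card_s8430h1_7 :
    Nat.card (((⟨1, 0, 0, -343976, 77614656⟩ : WeierstrassCurve ℤ).map (Int.castRingHom (ZMod 7))).toAffine.Point) = 8 := by
  rw [@WeierstrassCurve.natCard_point_eq_one_add_card (ZMod 7) (@ZMod.instField 7 ⟨by norm_num⟩) _ _ _
    (by decide +kernel), @card_sol_eq_sum_euler (ZMod 7) (@ZMod.instField 7 ⟨by norm_num⟩) _ _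
    (by rw [ZMod.ringChar_zmod_n]; decide), ZMod.card]
  decide +kernel

/-- `#Ẽ(𝔽_13) = 12` (`a_13 = 2`; `X² − a_13X + 13` root-free mod `p = 5`) for the semistable record `8610h1`. [folklore] -/
theorem card_s8610h1_13 :
    Nat.card (((⟨1, 0, 1, -5202453, -4537859744⟩ : WeierstrassCurve ℤ).map (Int.castRingHom (ZMod 13))).toAffine.Point) = 12 := by
  rw [@WeierstrassCurve.natCard_point_eq_one_add_card (ZMod 13) (@ZMod.instField 13 ⟨by norm_num⟩) _ _ _
    (by decide +kernel), @card_sol_eq_sum_euler (ZMod 13) (@ZMod.instField 13 ⟨by norm_num⟩) _ _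
    (by rw [ZMod.ringChar_zmod_n]; decide), ZMod.card]
  decide +kernel

/-- `#Ẽ(𝔽_7) = 8` (`a_7 = 0`; `X² − a_7X + 7` root-free mod `p = 5`) for the semistable record `8790h1`. [folklore] -/
theorem card_s8790h1_7 :
    Nat.card (((⟨1, 0, 1, -19238, 1025156⟩ : WeierstrassCurve ℤ).map (Int.castRingHom (ZMod 7))).toAffine.Point) = 8 := by
  rw [@WeierstrassCurve.natCard_point_eq_one_add_card (ZMod 7) (@ZMod.instField 7 ⟨by norm_num⟩) _ _ _
    (by decide +kernel), @card_sol_eq_sum_euler (ZMod 7) (@ZMod.instField 7 ⟨by norm_num⟩) _ _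
    (by rw [ZMod.ringChar_zmod_n]; decide), ZMod.card]
  decide +kernel

/-- `#Ẽ(𝔽_7) = 4` (`a_7 = 4`; `X² − a_7X + 7` root-free mod `p = 5`) for the semistable record `8870b1`. [folklore] -/
theorem card_s8870b1_7 :
    Nat.card (((⟨1, 0, 0, 110, 100⟩ : WeierstrassCurve ℤ).map (Int.castRingHom (ZMod 7))).toAffine.Point) = 4 := by
  rw [@WeierstrassCurve.natCard_point_eq_one_add_card (ZMod 7) (@ZMod.instField 7 ⟨by norm_num⟩) _ _ _
    (by decide +kernel), @card_sol_eq_sum_euler (ZMod 7) (@ZMod.instField 7 ⟨by norm_num⟩) _ _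
    (by rw [ZMod.ringChar_zmod_n]; decide), ZMod.card]
  decide +kernel

/-- `#Ẽ(𝔽_11) = 16` (`a_11 = -4`; `X² − a_11X + 11` root-free mod `p = 5`) for the semistable record `9345f1`. [folklore] -/
theorem card_s9345f1_11 :
    Nat.card (((⟨1, 0, 1, -113383, 14659181⟩ : WeierstrassCurve ℤ).map (Int.castRingHom (ZMod 11))).toAffine.Point) = 16 := by
  rw [@WeierstrassCurve.natCard_point_eq_one_add_card (ZMod 11) (@ZMod.instField 11 ⟨by norm_num⟩) _ _ _
    (by decide +kernel), @card_sol_eq_sum_euler (ZMod 11) (@ZMod.instField 11 ⟨by norm_num⟩) _ _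
    (by rw [ZMod.ringChar_zmod_n]; decide), ZMod.card]
  decide +kernel

/-- `#Ẽ(𝔽_7) = 7` (`a_7 = 1`; `X² − a_7X + 7` root-free mod `p = 5`) for the semistable record `9570s1`. [folklore] -/
theorem card_s9570s1_7 :
    Nat.card (((⟨1, 1, 1, 65, -763⟩ : WeierstrassCurve ℤ).map (Int.castRingHom (ZMod 7))).toAffine.Point) = 7 := by
  rw [@WeierstrassCurve.natCard_point_eq_one_add_card (ZMod 7) (@ZMod.instField 7 ⟨by norm_num⟩) _ _ _
    (by decide +kernel), @card_sol_eq_sum_euler (ZMod 7) (@ZMod.instField 7 ⟨by norm_num⟩) _ _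
    (by rw [ZMod.ringChar_zmod_n]; decide), ZMod.card]
  decide +kernel

/-- `#Ẽ(𝔽_13) = 17` (`a_13 = -3`; `X² − a_13X + 13` root-free mod `p = 5`) for the semistable record `9930q1`. [folklore] -/
theorem card_s9930q1_13 :
    Nat.card (((⟨1, 0, 0, 99, 81⟩ : WeierstrassCurve ℤ).map (Int.castRingHom (ZMod 13))).toAffine.Point) = 17 := by
  rw [@WeierstrassCurve.natCard_point_eq_one_add_card (ZMod 13) (@ZMod.instField 13 ⟨by norm_num⟩) _ _ _
    (by decide +kernel), @card_sol_eq_sum_euler (ZMod 13) (@ZMod.instField 13 ⟨by norm_num⟩) _ _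
    (by rw [ZMod.ringChar_zmod_n]; decide), ZMod.card]
  decide +kernel

/-- `#Ẽ(𝔽_11) = 16` (`a_11 = -4`; `X² − a_11X + 11` root-free mod `p = 5`) for the semistable record `11130bc1`. [folklore] -/
theorem card_s11130bc1_11 :
    Nat.card (((⟨1, 0, 0, -10875381, -13783068639⟩ : WeierstrassCurve ℤ).map (Int.castRingHom (ZMod 11))).toAffine.Point) = 16 := by
  rw [@WeierstrassCurve.natCard_point_eq_one_add_card (ZMod 11) (@ZMod.instField 11 ⟨by norm_num⟩) _ _ _
    (by decide +kernel), @card_sol_eq_sum_euler (ZMod 11) (@ZMod.instField 11 ⟨by norm_num⟩) _ _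
    (by rw [ZMod.ringChar_zmod_n]; decide), ZMod.card]
  decide +kernel

/-- `#Ẽ(𝔽_11) = 16` (`a_11 = -4`; `X² − a_11X + 11` root-free mod `p = 5`) for the semistable record `11130d1`. [folklore] -/
theorem card_s11130d1_11 :
    Nat.card (((⟨1, 1, 0, -132867933, -589547137923⟩ : WeierstrassCurve ℤ).map (Int.castRingHom (ZMod 11))).toAffine.Point) = 16 := by
  rw [@WeierstrassCurve.natCard_point_eq_one_add_card (ZMod 11) (@ZMod.instField 11 ⟨by norm_num⟩) _ _ _
    (by decide +kernel), @card_sol_eq_sum_euler (ZMod 11) (@ZMod.instField 11 ⟨by norm_num⟩) _ _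
    (by rw [ZMod.ringChar_zmod_n]; decide), ZMod.card]
  decide +kernel

/-- `#Ẽ(𝔽_3) = 2` (`a_3 = 2`; `X² − a_3X + 3` root-free mod `p = 7`) for the semistable record `11305d1`. [folklore] -/
theorem card_s11305d1_3 :
    Nat.card (((⟨1, 1, 0, -15725633, 23996163698⟩ : WeierstrassCurve ℤ).map (Int.castRingHom (ZMod 3))).toAffine.Point) = 2 := by
  rw [@WeierstrassCurve.natCard_point_eq_one_add_card (ZMod 3) (@ZMod.instField 3 ⟨by norm_num⟩) _ _ _
    (by decide +kernel), @card_sol_eq_sum_euler (ZMod 3) (@ZMod.instField 3 ⟨by norm_num⟩) _ _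
    (by rw [ZMod.ringChar_zmod_n]; decide), ZMod.card]
  decide +kernel

/-- `#Ẽ(𝔽_3) = 6` (`a_3 = -2`; `X² − a_3X + 3` root-free mod `p = 5`) for the semistable record `11590f1`. [folklore] -/
theorem card_s11590f1_3 :
    Nat.card (((⟨1, 0, 1, -5203, -152244⟩ : WeierstrassCurve ℤ).map (Int.castRingHom (ZMod 3))).toAffine.Point) = 6 := by
  rw [@WeierstrassCurve.natCard_point_eq_one_add_card (ZMod 3) (@ZMod.instField 3 ⟨by norm_num⟩) _ _ _
    (by decide +kernel), @card_sol_eq_sum_euler (ZMod 3) (@ZMod.instField 3 ⟨by norm_num⟩) _ _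
    (by rw [ZMod.ringChar_zmod_n]; decide), ZMod.card]
  decide +kernel

end Summit.BirchSwinnertonDyer.Rank1Residual.X11b
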